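import Mathlib
import HarnessLib
import Summits.HubbardSuperconductivity.HubbardSuperconductivity.Theorems.KLProgrammeKLRegimeTwoPointAssemblyDefs
import Literature.MathematicalPhysics.QuantumLattice.HubbardCovarianceFrameResolvent
import Literature.MathematicalPhysics.QuantumLattice.GrassmannChargeScaling

/-!
# Child 4 `KLRegimeTwoPointAssembly` of crux K3: frequency, momentum and spin CONSERVATION of the two-leg kernel of the fully
# integrated countertermed action (seat hubbard-kl-r2d-p2; supplier of the skeleton `Lines/asm-repr`)

`𝒢^K = fullActionCT L M β U μ K = effAction ℂ C^K V_K` is invariant under every charge scaling `ψ̂^±_{kσ} ↦ φ(k,σ)^{±1} ψ̂^±_{kσ}`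
whose weight `φ` is non-zero and compatible with the Hubbard vertex (`φ(k₁,↑)φ(k₃,↓) = φ(k₂,↑)φ(k₄,↓)` on `k₁+k₃ = k₂+k₄`): the
covariance `C^K` pairs only the reciprocal labels `ψ̂⁺_{kσ}`, `ψ̂⁻_{kσ}` (`hubbardCovarianceCT_eq_zero_of_fst_ne` at seed `h = 0`) and
`V_K = V + 𝒩_K` is invariant (`GrassmannChargeScaling.map_mulLeft_effAction_of_invariant`).  With `φ = 2^{n(ω)}` (Matsubara
integer), `φ = χ(k⃗ᵢ)` (`ZMod.stdAddChar`, injective) and `φ = 2^{[σ=↑]}` the selection rule `kernel_eq_zero_of_invariant` gives: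
the two-point kernel `kernel 𝒢^K 2 ![X, Y]` VANISHES unless `X` and `Y` carry the same frequency, momentum and spin
(`kernel_fullActionCT_two_eq_zero_of_ne`).  Model-level symmetry bookkeeping; nothing about limits.
-/

noncomputable section

namespace Summit.HubbardSuperconductivity.HubbardSuperconductivity.Theorems.TwoPointAssembly

set_option linter.dupNamespace false -- summit = problem name (single-conjunct summit), D-0017

open Literature.MathematicalPhysics.QuantumLattice Literature.Probability.LatticeModels GrassmannAlgebra Finset

variable {L M : ℕ} [NeZero L]

/-! ## §1 The covariance pairs only reciprocal labels (seed `h = 0`) -/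

omit [NeZero L] in
/-- Momentum reflection is injective on `FreqMomentum`. -/
theorem FreqMomentum.neg_eq_neg_iff (k k' : FreqMomentum L M) : k.neg = k'.neg ↔ k = k' :=
  FreqMomentum.neg_involutive.injective.eq_iff

omit [NeZero L] in
/-- At zero seed the Nambu propagator is diagonal. -/
theorem nambuPropagatorCT_zero_seed_offdiag (β μ : ℝ) (K : TrigPolyC4v) (k : FreqMomentum L M) {a b : Fin 2} (hab : a ≠ b) :
    nambuPropagatorCT L M β μ 0 K k a b = 0 := by
  fin_cases a <;> fin_cases b <;> simp_all [nambuPropagatorCT]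

omit [NeZero L] in
/-- **`C^K(X, Y) = 0` unless `X` and `Y` have the same frequency–momentum and spin** (seed `h = 0`). -/
theorem hubbardCovarianceCT_eq_zero_of_fst_ne (β μ : ℝ) (K : TrigPolyC4v) {X Y : HubbardFieldIdx L M} (hXY : X.1 ≠ Y.1) :
    hubbardCovarianceCT L M β μ 0 K X Y = 0 := by
  obtain ⟨⟨kx, sx⟩, cx⟩ := X
  obtain ⟨⟨ky, sy⟩, cy⟩ := Y
  simp only [ne_eq, Prod.mk.injEq, not_and] at hXY
  rw [hubbardCovarianceCT_apply]
  fin_cases sx <;> fin_cases sy <;> fin_cases cx <;> fin_cases cy <;>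
    simp_all [nambuAnti_one_zero, nambuAnti_zero_one, nambuAnti_zero_zero, nambuAnti_one_one,
      nambuPropagatorCT_zero_seed_offdiag, FreqMomentum.neg_eq_neg_iff]

omit [NeZero L] in
/-- **`C^K(X, Y) = 0` for equal charges** (seed `h = 0`: no anomalous pairing). -/
theorem hubbardCovarianceCT_eq_zero_of_charge_eq (β μ : ℝ) (K : TrigPolyC4v) {X Y : HubbardFieldIdx L M} (hXY : X.2 = Y.2) :
    hubbardCovarianceCT L M β μ 0 K X Y = 0 := by
  obtain ⟨⟨kx, sx⟩, cx⟩ := X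
  obtain ⟨⟨ky, sy⟩, cy⟩ := Y
  simp only at hXY
  subst hXY
  rw [hubbardCovarianceCT_apply]
  fin_cases sx <;> fin_cases sy <;> fin_cases cx <;>
    simp_all [nambuAnti_one_zero, nambuAnti_zero_one, nambuAnti_zero_zero, nambuAnti_one_one,
      nambuPropagatorCT_zero_seed_offdiag]

/-! ## §2 Charge scalings compatible with the Hubbard vertex leave `𝒢^K` invariant -/

/-- The weight of a label under the scaling built from `φ`: `ψ̂⁺_{kσ} ↦ φ(k,σ) ψ̂⁺_{kσ}`, `ψ̂⁻_{kσ} ↦ φ(k,σ)⁻¹ ψ̂⁻_{kσ}`. -/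
def scalingWeight (φ : FreqMomentum L M × Fin 2 → ℂ) (X : HubbardFieldIdx L M) : ℂ :=
  if X.2 = 0 then φ X.1 else (φ X.1)⁻¹

/-- The inverse weight. -/
def scalingWeightInv (φ : FreqMomentum L M × Fin 2 → ℂ) (X : HubbardFieldIdx L M) : ℂ :=
  if X.2 = 0 then (φ X.1)⁻¹ else φ X.1

omit [NeZero L] in
/-- The inverse weight times the weight is `1`. -/
theorem scalingWeightInv_mul (φ : FreqMomentum L M × Fin 2 → ℂ) (hφ : ∀ p, φ p ≠ 0) :
    scalingWeightInv φ * scalingWeight φ = 1 := by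
  funext X
  simp only [Pi.mul_apply, Pi.one_apply, scalingWeight, scalingWeightInv]
  split_ifs <;> field_simp [hφ X.1]

omit [NeZero L] in
/-- Reciprocal labels have reciprocal weights. -/
theorem scalingWeight_plus_mul_minus (φ : FreqMomentum L M × Fin 2 → ℂ) (hφ : ∀ p, φ p ≠ 0) (p : FreqMomentum L M × Fin 2) :
    scalingWeight φ (p, 0) * scalingWeight φ (p, 1) = 1 := by
  simp [scalingWeight, hφ p]

omit [NeZero L] in
/-- The covariance is invariant under every such scaling. -/
theorem scalingWeight_covariance_invariant (φ : FreqMomentum L M × Fin 2 → ℂ) (hφ : ∀ p, φ p ≠ 0) (β μ : ℝ) (K : TrigPolyC4v)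
    (X Y : HubbardFieldIdx L M) :
    scalingWeight φ X * scalingWeight φ Y * hubbardCovarianceCT L M β μ 0 K X Y = hubbardCovarianceCT L M β μ 0 K X Y := by
  by_cases h1 : X.1 = Y.1
  · by_cases h2 : X.2 = Y.2
    · rw [hubbardCovarianceCT_eq_zero_of_charge_eq β μ K h2, mul_zero]
    · -- reciprocal labels
      have hw : scalingWeight φ X * scalingWeight φ Y = 1 := by
        obtain ⟨p, cx⟩ := X
        obtain ⟨q, cy⟩ := Y
        simp only at h1 h2
        subst h1
        fin_cases cx <;> fin_cases cy <;> simp_all [scalingWeight, hφ p]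
      rw [hw, one_mul]
  · rw [hubbardCovarianceCT_eq_zero_of_fst_ne β μ K h1, mul_zero]

/-- The counterterm vertex is invariant. -/
theorem map_scaling_counterQuadratic (φ : FreqMomentum L M × Fin 2 → ℂ) (hφ : ∀ p, φ p ≠ 0) (β : ℝ) (K : TrigPolyC4v) :
    ExteriorAlgebra.map (LinearMap.mulLeft ℂ (scalingWeight φ)) (counterQuadratic L M β K) = counterQuadratic L M β K := by
  rw [counterQuadratic]
  simp only [map_sum, map_smul, map_mul, psiPlus, psiMinus, map_mulLeft_gen, smul_mul_smul_comm]
  refine Finset.sum_congr rfl fun k _ => Finset.sum_congr rfl fun σ _ => ?_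
  rw [scalingWeight_plus_mul_minus φ hφ, one_smul]

omit [NeZero L] in
/-- One vertex monomial under a compatible scaling. -/
theorem map_scaling_vertexTerm (φ : FreqMomentum L M × Fin 2 → ℂ) (hφ : ∀ p, φ p ≠ 0)
    (hV : ∀ k₁ k₂ k₃ k₄ : FreqMomentum L M,
      matsubaraInt M k₁.1 + matsubaraInt M k₃.1 = matsubaraInt M k₂.1 + matsubaraInt M k₄.1 ∧ k₁.2 + k₃.2 = k₂.2 + k₄.2 →
        φ (k₁, 0) * φ (k₃, 1) = φ (k₂, 0) * φ (k₄, 1))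
    (k₁ k₂ k₃ k₄ : FreqMomentum L M) :
    ExteriorAlgebra.map (LinearMap.mulLeft ℂ (scalingWeight φ))
        (if matsubaraInt M k₁.1 + matsubaraInt M k₃.1 = matsubaraInt M k₂.1 + matsubaraInt M k₄.1 ∧ k₁.2 + k₃.2 = k₂.2 + k₄.2 then
          psiPlus k₁ 0 * psiMinus k₂ 0 * psiPlus k₃ 1 * psiMinus k₄ 1 else 0) =
      (if matsubaraInt M k₁.1 + matsubaraInt M k₃.1 = matsubaraInt M k₂.1 + matsubaraInt M k₄.1 ∧ k₁.2 + k₃.2 = k₂.2 + k₄.2 then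
          psiPlus k₁ 0 * psiMinus k₂ 0 * psiPlus k₃ 1 * psiMinus k₄ 1 else 0 : HubbardGrassmann L M) := by
  split_ifs with hc
  · simp only [map_mul, psiPlus, psiMinus, map_mulLeft_gen, smul_mul_smul_comm]
    have e : φ (k₁, 0) * φ (k₃, 1) = φ (k₂, 0) * φ (k₄, 1) := hV k₁ k₂ k₃ k₄ hc
    have hw : scalingWeight φ (((k₁, 0), 0) : HubbardFieldIdx L M) * scalingWeight φ (((k₂, 0), 1) : HubbardFieldIdx L M) *
        scalingWeight φ (((k₃, 1), 0) : HubbardFieldIdx L M) * scalingWeight φ (((k₄, 1), 1) : HubbardFieldIdx L M) = 1 := by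
      simp only [scalingWeight, Fin.isValue, ↓reduceIte, one_ne_zero]
      calc φ (k₁, 0) * (φ (k₂, 0))⁻¹ * φ (k₃, 1) * (φ (k₄, 1))⁻¹
          = (φ (k₁, 0) * φ (k₃, 1)) * (φ (k₂, 0) * φ (k₄, 1))⁻¹ := by rw [mul_inv]; ring
        _ = 1 := by rw [e, mul_inv_cancel₀ (mul_ne_zero (hφ _) (hφ _))]
    rw [hw, one_smul]
  · exact map_zero _

/-- The Hubbard vertex is invariant under a scaling COMPATIBLE with it. -/
theorem map_scaling_hubbardInteraction (φ : FreqMomentum L M × Fin 2 → ℂ) (hφ : ∀ p, φ p ≠ 0)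
    (hV : ∀ k₁ k₂ k₃ k₄ : FreqMomentum L M,
      matsubaraInt M k₁.1 + matsubaraInt M k₃.1 = matsubaraInt M k₂.1 + matsubaraInt M k₄.1 ∧ k₁.2 + k₃.2 = k₂.2 + k₄.2 →
        φ (k₁, 0) * φ (k₃, 1) = φ (k₂, 0) * φ (k₄, 1))
    (β U : ℝ) :
    ExteriorAlgebra.map (LinearMap.mulLeft ℂ (scalingWeight φ)) (hubbardInteraction L M β U) = hubbardInteraction L M β U := by
  rw [hubbardInteraction]
  simp only [map_smul, map_sum, map_scaling_vertexTerm φ hφ hV]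

/-- **`𝒢^K` is invariant** under every non-zero vertex-compatible scaling. -/
theorem map_scaling_fullActionCT (φ : FreqMomentum L M × Fin 2 → ℂ) (hφ : ∀ p, φ p ≠ 0)
    (hV : ∀ k₁ k₂ k₃ k₄ : FreqMomentum L M,
      matsubaraInt M k₁.1 + matsubaraInt M k₃.1 = matsubaraInt M k₂.1 + matsubaraInt M k₄.1 ∧ k₁.2 + k₃.2 = k₂.2 + k₄.2 →
        φ (k₁, 0) * φ (k₃, 1) = φ (k₂, 0) * φ (k₄, 1))
    (β U μ : ℝ) (K : TrigPolyC4v) :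
    ExteriorAlgebra.map (LinearMap.mulLeft ℂ (scalingWeight φ)) (fullActionCT L M β U μ K) = fullActionCT L M β U μ K := by
  rw [fullActionCT]
  refine map_mulLeft_effAction_of_invariant ℂ (scalingWeightInv_mul φ hφ)
    (fun X Y => scalingWeight_covariance_invariant φ hφ β μ K X Y) ?_
  rw [hubbardInteractionCT, map_add, map_scaling_hubbardInteraction φ hφ hV, map_scaling_counterQuadratic φ hφ]

/-- The selection rule for the two-point kernel under a compatible scaling. -/
theorem kernel_fullActionCT_two_eq_zero_of_weight_ne (φ : FreqMomentum L M × Fin 2 → ℂ) (hφ : ∀ p, φ p ≠ 0)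
    (hV : ∀ k₁ k₂ k₃ k₄ : FreqMomentum L M,
      matsubaraInt M k₁.1 + matsubaraInt M k₃.1 = matsubaraInt M k₂.1 + matsubaraInt M k₄.1 ∧ k₁.2 + k₃.2 = k₂.2 + k₄.2 →
        φ (k₁, 0) * φ (k₃, 1) = φ (k₂, 0) * φ (k₄, 1))
    (β U μ : ℝ) (K : TrigPolyC4v) {X Y : HubbardFieldIdx L M} (hw : scalingWeight φ X * scalingWeight φ Y ≠ 1) :
    kernel ℂ (fullActionCT L M β U μ K) 2 ![X, Y] = 0 := by
  refine kernel_eq_zero_of_invariant ℂ (scalingWeight φ) (map_scaling_fullActionCT φ hφ hV β U μ K) ?_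
  simpa [Fin.prod_univ_two] using hw

/-! ## §3 The three conservation laws -/

omit [NeZero L] in
/-- The weight of the pair `(ψ̂⁻_p, ψ̂⁺_q)` is `φ(p)⁻¹ φ(q)`; it is `1` iff `φ p = φ q`. -/
theorem scalingWeight_pair_ne_one {φ : FreqMomentum L M × Fin 2 → ℂ} (hφ : ∀ p, φ p ≠ 0) {p q : FreqMomentum L M × Fin 2}
    (h : φ p ≠ φ q) :
    scalingWeight φ (((p, 1)) : HubbardFieldIdx L M) * scalingWeight φ (((q, 0)) : HubbardFieldIdx L M) ≠ 1 := by
  simp only [scalingWeight, Fin.isValue, one_ne_zero, ↓reduceIte]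
  rw [Ne, inv_mul_eq_one₀ (hφ p)]
  exact h

omit [NeZero L] in
/-- The same for the pair `(ψ̂⁺_p, ψ̂⁻_q)`: weight `φ(p) φ(q)⁻¹`. -/
theorem scalingWeight_pair_ne_one' {φ : FreqMomentum L M × Fin 2 → ℂ} (hφ : ∀ p, φ p ≠ 0) {p q : FreqMomentum L M × Fin 2}
    (h : φ p ≠ φ q) :
    scalingWeight φ (((p, 0)) : HubbardFieldIdx L M) * scalingWeight φ (((q, 1)) : HubbardFieldIdx L M) ≠ 1 := by
  simp only [scalingWeight, Fin.isValue, one_ne_zero, ↓reduceIte]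
  rw [Ne, mul_inv_eq_one₀ (hφ q)]
  exact h

/-- A vertex-compatible non-zero weight separating `p` from `q` kills both mixed-charge two-point kernels at `(p, q)`. -/
theorem kernel_fullActionCT_two_eq_zero_of_separating (φ : FreqMomentum L M × Fin 2 → ℂ) (hφ : ∀ p, φ p ≠ 0)
    (hV : ∀ k₁ k₂ k₃ k₄ : FreqMomentum L M,
      matsubaraInt M k₁.1 + matsubaraInt M k₃.1 = matsubaraInt M k₂.1 + matsubaraInt M k₄.1 ∧ k₁.2 + k₃.2 = k₂.2 + k₄.2 →
        φ (k₁, 0) * φ (k₃, 1) = φ (k₂, 0) * φ (k₄, 1))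
    (β U μ : ℝ) (K : TrigPolyC4v) {p q : FreqMomentum L M × Fin 2} (h : φ p ≠ φ q) :
    kernel ℂ (fullActionCT L M β U μ K) 2 ![((p, 1) : HubbardFieldIdx L M), (q, 0)] = 0 ∧
      kernel ℂ (fullActionCT L M β U μ K) 2 ![((p, 0) : HubbardFieldIdx L M), (q, 1)] = 0 :=
  ⟨kernel_fullActionCT_two_eq_zero_of_weight_ne φ hφ hV β U μ K (scalingWeight_pair_ne_one hφ h),
    kernel_fullActionCT_two_eq_zero_of_weight_ne φ hφ hV β U μ K (scalingWeight_pair_ne_one' hφ h)⟩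

/-- `ZMod.stdAddChar` never vanishes. -/
theorem stdAddChar_ne_zero (j : ZMod L) : (ZMod.stdAddChar j : ℂ) ≠ 0 := by
  rw [ZMod.stdAddChar_apply]; exact Circle.coe_ne_zero _

omit [NeZero L] in
/-- Integer powers of `2` are injective in `ℂ`. -/
theorem two_zpow_injective {m n : ℤ} (h : (2 : ℂ) ^ m = (2 : ℂ) ^ n) : m = n := by
  have h' : (2 : ℝ) ^ m = (2 : ℝ) ^ n := by
    have := congrArg norm h
    simpa [norm_zpow] using this
  exact zpow_right_injective₀ (by norm_num) (by norm_num) h'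

/-- **Conservation of frequency, momentum and spin by the two-point kernel of `𝒢^K`**: for mixed-charge label pairs with
different `(frequency, momentum, spin)` BOTH two-point kernels vanish. -/
theorem kernel_fullActionCT_two_eq_zero_of_ne (β U μ : ℝ) (K : TrigPolyC4v) {p q : FreqMomentum L M × Fin 2} (hpq : p ≠ q) :
    kernel ℂ (fullActionCT L M β U μ K) 2 ![((p, 1) : HubbardFieldIdx L M), (q, 0)] = 0 ∧
      kernel ℂ (fullActionCT L M β U μ K) 2 ![((p, 0) : HubbardFieldIdx L M), (q, 1)] = 0 := by
  obtain ⟨⟨ω, k⟩, σ⟩ := p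
  obtain ⟨⟨ω', k'⟩, σ'⟩ := q
  by_cases hω : ω = ω'
  · subst hω
    by_cases hk : k = k'
    · subst hk
      have hσ : σ ≠ σ' := fun h => hpq (by rw [h])
      -- spin: weight `2^{[σ = ↑]}`
      refine kernel_fullActionCT_two_eq_zero_of_separating (fun p => if p.2 = 0 then 2 else 1)
        (fun p => by split_ifs <;> norm_num) (fun k₁ k₂ k₃ k₄ _ => by simp) β U μ K ?_
      fin_cases σ <;> fin_cases σ' <;> simp_all
    · -- momentum: some coordinate differs; weight `χ(k⃗ᵢ)`
      obtain ⟨i, hi⟩ : ∃ i, k i ≠ k' i := Function.ne_iff.mp hk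
      refine kernel_fullActionCT_two_eq_zero_of_separating (fun p => (ZMod.stdAddChar (p.1.2 i) : ℂ))
        (fun p => stdAddChar_ne_zero _) (fun k₁ k₂ k₃ k₄ h => ?_) β U μ K ?_
      · rw [← AddChar.map_add_eq_mul, ← AddChar.map_add_eq_mul, ← Pi.add_apply k₁.2, ← Pi.add_apply k₂.2, h.2]
      · exact fun h => hi (ZMod.injective_stdAddChar h)
  · -- frequency: weight `2^{n(ω)}`
    refine kernel_fullActionCT_two_eq_zero_of_separating (fun p => (2 : ℂ) ^ (matsubaraInt M p.1.1))
      (fun p => zpow_ne_zero _ two_ne_zero) (fun k₁ k₂ k₃ k₄ h => ?_) β U μ K ?_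
    · rw [← zpow_add₀ two_ne_zero, ← zpow_add₀ two_ne_zero, h.1]
    · intro h
      dsimp only at h
      apply hω
      have h2 := two_zpow_injective h
      unfold matsubaraInt at h2
      exact Fin.ext (by omega)

end Summit.HubbardSuperconductivity.HubbardSuperconductivity.Theorems.TwoPointAssembly

end
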